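import Summits.PneNP.PneNP.Theorems.SymmetryBudgetNoHiddenOrderBranchSumPotential

/-!
# BranchSum V: no re-growth of entered cells (CG84-FLATNESS.md §10.1, Fact F3)

A structural fact about individualisation–refinement paths complementing the branch-sum bound
`BranchSum.RefinementPath.sum_d_le` (CG84-FLATNESS.md Thm 9.1).  On top of a `RefinementPath`
consider ENTERED-VERTEX data: at every node `k < N` a vertex `x k ∈ W k` that is dropped at the
transition `k → k+1` and whose cell — the entered cell `A_k` — has exactly `d k` elements.  In the
Corneil–Goldberg process with component sections (B. Laubner, PhD thesis HU Berlin 2011, ch. 3;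
CG84-FLATNESS §9.0) `x k` is the individualised vertex and `A_k` the first smallest cell.  The
hypothesis is kept unbundled (`hx` below) so that this file is a pure proof file.  Then:

* `disjoint_enteredCell_W` (**no re-growth**): if `k < k'` and `d k ≤ d k'`, the entered cell of
  node `k` is disjoint from `W k'` — every node-`k'` cell inside `A_k ∖ {x_k}` has at most
  `d k - 1 < d k ≤ d k'` elements, but `d k'` is a lower bound for the cells of node `k'`;
* `sum_d_le_card_of_monotone` : along every subsequence of nodes on which `d` is non-decreasing the
  entered cells are pairwise disjoint, so these `d`'s sum to at most `|V|`;
* `card_filter_d_eq_mul_le_card` : in particular, for every `c`, the number of nodes with `d k = c`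
  is at most `|V| / c`.

So a superlinear branch sum can only come from long strictly DECREASING runs of the profile that
return to large values after everything entered in between has been removed (memo §10.2).
-/

namespace Summit.PneNP.PneNP.Theorems

open Finset

namespace BranchSum

variable {V : Type*} [DecidableEq V] {G : SimpleGraph V} [DecidableRel G.Adj] {N : ℕ}

namespace RefinementPath

variable (R : RefinementPath G N)

/-- **No re-growth (F3).** Let `x k` (`k < N`) be present at node `k`, dropped at `k → k+1`, with a
cell of exactly `d k` elements.  If `k < k'` and `d k ≤ d k'` then the entered cell `cell k (x k)`
does not meet `W k'`. -/
theorem disjoint_enteredCell_W (x : ℕ → V)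
    (hx : ∀ k < N, x k ∈ R.W k ∧ x k ∉ R.W (k + 1) ∧ (R.cell k (x k)).card = R.d k)
    {k k' : ℕ} (hkk' : k < k') (hd : R.d k ≤ R.d k') :
    Disjoint (R.cell k (x k)) (R.W k') := by
  rw [disjoint_left]
  intro u hu huW
  have hk : k < N := lt_trans hkk' (R.lt_N_of_mem huW)
  obtain ⟨hxW, hxW', hcardA⟩ := hx k hk
  -- the node-`k'` cell of `u` lies inside `A_k` and avoids `x_k`
  have hsub : R.cell k' u ⊆ (R.cell k (x k)).erase (x k) := by
    intro v hv
    have hvW : v ∈ R.W k' := (R.mem_cell_iff.1 hv).1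
    refine mem_erase.2 ⟨?_, ?_⟩
    · rintro rfl
      exact hxW' (R.W_subset_of_le (Nat.succ_le_of_lt hkk') hvW)
    · have h1 : v ∈ R.cell k u := R.cell_subset_cell_of_le (le_of_lt hkk') huW hv
      rwa [R.cell_eq_of_mem hu] at h1
  have hcard : (R.cell k' u).card ≤ R.d k - 1 := by
    have := card_le_card hsub
    rwa [card_erase_of_mem (R.self_mem_cell hxW), hcardA] at this
  have hdk' : R.d k' ≤ (R.cell k' u).card := R.d_le k' u huW
  have htwo : 2 ≤ R.d k := by rw [← hcardA]; exact R.two_le k _ hxW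
  omega

/-- Entered cells of two nodes `k < k'` with `d k ≤ d k'` are disjoint. -/
theorem disjoint_enteredCell (x : ℕ → V)
    (hx : ∀ k < N, x k ∈ R.W k ∧ x k ∉ R.W (k + 1) ∧ (R.cell k (x k)).card = R.d k)
    {k k' : ℕ} (hkk' : k < k') (hd : R.d k ≤ R.d k') :
    Disjoint (R.cell k (x k)) (R.cell k' (x k')) :=
  (R.disjoint_enteredCell_W x hx hkk' hd).mono_right (R.cell_subset_W k' _)

variable [Fintype V]

/-- **Non-decreasing subsequences of the branching profile sum to at most `|V|`.** If
`κ 0 < κ 1 < … < κ (r-1) < N` are nodes along which `d` is non-decreasing, then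
`Σ_{i<r} d (κ i) ≤ |V|` (the entered cells along the subsequence are pairwise disjoint). -/
theorem sum_d_le_card_of_monotone (x : ℕ → V)
    (hx : ∀ k < N, x k ∈ R.W k ∧ x k ∉ R.W (k + 1) ∧ (R.cell k (x k)).card = R.d k)
    (κ : ℕ → ℕ) (r : ℕ) (hκ : ∀ i j, i < j → j < r → κ i < κ j)
    (hN : ∀ i < r, κ i < N) (hd : ∀ i j, i < j → j < r → R.d (κ i) ≤ R.d (κ j)) :
    ∑ i ∈ range r, R.d (κ i) ≤ Fintype.card V := by
  have hdisj : ∀ i ∈ range r, ∀ j ∈ range r, i ≠ j →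
      Disjoint (R.cell (κ i) (x (κ i))) (R.cell (κ j) (x (κ j))) := by
    intro i hi j hj hij
    rcases lt_or_gt_of_ne hij with h | h
    · exact R.disjoint_enteredCell x hx (hκ i j h (mem_range.1 hj)) (hd i j h (mem_range.1 hj))
    · exact (R.disjoint_enteredCell x hx (hκ j i h (mem_range.1 hi)) (hd j i h (mem_range.1 hi))).symm
  calc ∑ i ∈ range r, R.d (κ i) = ∑ i ∈ range r, (R.cell (κ i) (x (κ i))).card :=
        sum_congr rfl fun i hi => ((hx _ (hN i (mem_range.1 hi))).2.2).symm
    _ = ((range r).biUnion fun i => R.cell (κ i) (x (κ i))).card := (card_biUnion hdisj).symm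
    _ ≤ Fintype.card V := card_le_univ _

/-- **Entries of equal size.** For every `c`: (number of nodes `k < N` with `d k = c`) `* c ≤ |V|`,
since the entered cells of those nodes are pairwise disjoint and have `c` elements each. -/
theorem card_filter_d_eq_mul_le_card (x : ℕ → V)
    (hx : ∀ k < N, x k ∈ R.W k ∧ x k ∉ R.W (k + 1) ∧ (R.cell k (x k)).card = R.d k) (c : ℕ) :
    ((range N).filter fun k => R.d k = c).card * c ≤ Fintype.card V := by
  set F := (range N).filter fun k => R.d k = c
  have hdisj : ∀ i ∈ F, ∀ j ∈ F, i ≠ j → Disjoint (R.cell i (x i)) (R.cell j (x j)) := by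
    intro i hi j hj hij
    have hdi : R.d i = c := (mem_filter.1 hi).2
    have hdj : R.d j = c := (mem_filter.1 hj).2
    rcases lt_or_gt_of_ne hij with h | h
    · exact R.disjoint_enteredCell x hx h (by rw [hdi, hdj])
    · exact (R.disjoint_enteredCell x hx h (by rw [hdi, hdj])).symm
  calc F.card * c = ∑ i ∈ F, c := by rw [sum_const, smul_eq_mul]
    _ = ∑ i ∈ F, (R.cell i (x i)).card := sum_congr rfl fun i hi => by
        rw [(hx i (mem_range.1 (mem_filter.1 hi).1)).2.2, (mem_filter.1 hi).2]
    _ = (F.biUnion fun i => R.cell i (x i)).card := (card_biUnion hdisj).symm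
    _ ≤ Fintype.card V := card_le_univ _

end RefinementPath

end BranchSum

end Summit.PneNP.PneNP.Theorems
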